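import Summits.RiemannHypothesis.RiemannHypothesis.Theorems.UniversalFactorMediumHighDefs
import Summits.RiemannHypothesis.RiemannHypothesis.Theorems.UniversalFactorLehmerFactorBox

/-!
# RiemannHypothesis / UniversalFactor — `MediumKernelNoGo`, high window: soundness of the data and sums

Route `RiemannHypothesis/UniversalFactor`, crux `MediumKernelNoGo` (stmt-RiemannHypothesis-2577), line
`one-sided-average-sign-test`, stub `stub_highWindow`.  Invariants of `UniversalFactorMediumHighDefs.lean`:
the scaled rule, cells and nodes, the point data (`hiNodeRe_mem`, `hiCellData_spec`, `hiSideData_spec`),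
and the interval-weighted sums (`hiCellSum_mem`, `hiSideSum_mem`): for every `a` of the box the number
`Σ_c Σ_j W_j e^{−2a d_{cj}} Re F_0(½ + it_{cj})` lies in `hiSideSum`.
-/

set_option linter.dupNamespace false

namespace Summit.RiemannHypothesis.RiemannHypothesis.Theorems

open Complex Real Finset
open Literature.NumberTheory.LFunctions Literature.NumberTheory.LFunctions.ZetaNumerics
open Literature.Analysis.SpecialFunctions.Complex (stirlingPrim)
open Literature.Analysis.ValidatedNumerics Literature.Analysis.ValidatedNumerics.NumericsMP


/-- `hiU` is the cast of `hiUQ`. [folklore] -/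
theorem UniversalFactor.hiU_eq_cast (ρD j : ℕ) : UniversalFactor.hiU ρD j = (UniversalFactor.hiUQ ρD j : ℝ) := by
  simp [UniversalFactor.hiU, UniversalFactor.hiUQ]

/-- `hiWt` is the cast of `hiWQ`. [folklore] -/
theorem UniversalFactor.hiWt_eq_cast (ρD j : ℕ) : UniversalFactor.hiWt ρD j = (UniversalFactor.hiWQ ρD j : ℝ) := by
  simp [UniversalFactor.hiWt, UniversalFactor.hiWQ]

/-- The rational defect is the real `quadDefect` of the scaled rule (`K = 31`, `R = 1/4`). [folklore] -/
theorem UniversalFactor.hiDefectQ_cast (ρD : ℕ) :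
    (UniversalFactor.hiDefectQ ρD : ℝ) =
      UniversalFactor.quadDefect (Finset.range 16) (UniversalFactor.hiU ρD) (UniversalFactor.hiWt ρD) (1 / ρD) (1 / 4) 31 := by
  unfold UniversalFactor.hiDefectQ UniversalFactor.quadDefect
  simp only [UniversalFactor.hiU_eq_cast, UniversalFactor.hiWt_eq_cast]
  push_cast
  rfl

/-- All tabulated nodes are `≤ 10³⁶` in absolute value. [folklore] -/
theorem UniversalFactor.glNodes_abs_le : ∀ x ∈ UniversalFactor.glNodes, |x| ≤ (UniversalFactor.glScale : ℤ) := by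
  decide

/-- `|glNodes[j]| ≤ 10³⁶` for every index (default `0` beyond the table). [folklore] -/
theorem UniversalFactor.glNodes_getD_abs_le (j : ℕ) : |UniversalFactor.glNodes.getD j 0| ≤ (UniversalFactor.glScale : ℤ) := by
  rw [List.getD_eq_getElem?_getD]
  cases h : UniversalFactor.glNodes[j]? with
  | none => simp [UniversalFactor.glScale]
  | some x => simpa using UniversalFactor.glNodes_abs_le x (List.mem_of_getElem? h)

/-- `|u_j| ≤ 1/ρD`. [folklore] -/
theorem UniversalFactor.abs_hiU_le {ρD : ℕ} (hρ : 0 < ρD) (j : ℕ) : |UniversalFactor.hiU ρD j| ≤ 1 / ρD := by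
  unfold UniversalFactor.hiU
  have hsc : (0 : ℝ) < UniversalFactor.glScale := by unfold UniversalFactor.glScale; positivity
  have hρr : (0 : ℝ) < ρD := by exact_mod_cast hρ
  have h := UniversalFactor.glNodes_getD_abs_le j
  have h' : |((UniversalFactor.glNodes.getD j 0 : ℤ) : ℝ)| ≤ (UniversalFactor.glScale : ℝ) := by exact_mod_cast h
  rw [abs_div, abs_mul, abs_of_pos hρr, abs_of_pos hsc, div_le_div_iff₀ (by positivity) hρr]
  nlinarith


/-- The centre of cell `c` is `t₀ ∓ (2c+1)/ρD` (`t₀ = 700508/100`). [folklore] -/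
theorem UniversalFactor.hiCellT_eq {ρD : ℕ} (hρ : 0 < ρD) (fwd : Bool) (c : ℕ) :
    UniversalFactor.hiCellT ρD fwd c =
      UniversalFactor.lehmerT0 + (if fwd then 1 else -1) * ((2 * c + 1) / ρD) := by
  unfold UniversalFactor.hiCellT UniversalFactor.hiCellTn UniversalFactor.hiCellTd UniversalFactor.lehmerT0
  have hρr : (ρD : ℝ) ≠ 0 := by exact_mod_cast hρ.ne'
  have hd : (UniversalFactor.lehmerT0D : ℝ) ≠ 0 := by unfold UniversalFactor.lehmerT0D; norm_num
  split_ifs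
  · push_cast; field_simp
  · push_cast; field_simp; ring

/-- The node ordinate `hiNodeA/hiNodeB = T_c + u_j`. [folklore] -/
theorem UniversalFactor.hiNode_eq {ρD : ℕ} (hρ : 0 < ρD) (fwd : Bool) (c j : ℕ) :
    ((UniversalFactor.hiNodeA ρD fwd c j : ℤ) : ℝ) / (UniversalFactor.hiNodeB ρD : ℝ) =
      UniversalFactor.hiCellT ρD fwd c + UniversalFactor.hiU ρD j := by
  unfold UniversalFactor.hiNodeA UniversalFactor.hiNodeB UniversalFactor.hiCellT UniversalFactor.hiCellTd UniversalFactor.hiU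
  have hρr : (ρD : ℝ) ≠ 0 := by exact_mod_cast hρ.ne'
  have hd : (UniversalFactor.lehmerT0D : ℝ) ≠ 0 := by unfold UniversalFactor.lehmerT0D; norm_num
  have hsc : (UniversalFactor.glScale : ℝ) ≠ 0 := by unfold UniversalFactor.glScale; norm_num
  push_cast
  field_simp

/-- `T_c > 0` whenever `(2c+1)/ρD < t₀` (always in the certificate, where `(2c+1)/ρD ≤ 10`). [folklore] -/
theorem UniversalFactor.hiCellTn_pos {ρD : ℕ} (fwd : Bool) {c : ℕ} (hc : 2 * c + 1 ≤ 10 * ρD) :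
    0 < UniversalFactor.hiCellTn ρD fwd c := by
  unfold UniversalFactor.hiCellTn UniversalFactor.lehmerT0N UniversalFactor.lehmerT0D
  have : (2 * (c : ℤ) + 1) ≤ 10 * ρD := by exact_mod_cast hc
  push_cast
  split_ifs <;> nlinarith

/-- The denominator of the centres is positive and at most the numerator. [folklore] -/
theorem UniversalFactor.hiCellTd_le {ρD : ℕ} (hρ : 0 < ρD) (fwd : Bool) {c : ℕ} (hc : 2 * c + 1 ≤ 10 * ρD) :
    0 < UniversalFactor.hiCellTd ρD ∧ UniversalFactor.hiCellTd ρD ≤ (UniversalFactor.hiCellTn ρD fwd c).toNat := by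
  have hpos := UniversalFactor.hiCellTn_pos fwd hc (ρD := ρD)
  refine ⟨by unfold UniversalFactor.hiCellTd UniversalFactor.lehmerT0D; positivity, ?_⟩
  have h : (UniversalFactor.hiCellTd ρD : ℤ) ≤ UniversalFactor.hiCellTn ρD fwd c := by
    unfold UniversalFactor.hiCellTd UniversalFactor.hiCellTn UniversalFactor.lehmerT0N UniversalFactor.lehmerT0D
    have : (2 * (c : ℤ) + 1) ≤ 10 * ρD := by exact_mod_cast hc
    push_cast
    split_ifs <;> nlinarith
  omega


/-- The fields of a context built by `mkCtx`. [folklore] -/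
theorem UniversalFactor.mkCtx_fields {T : Tables} {Klog t0N t0D : ℕ} {C : UniversalFactor.LCtx}
    (h : UniversalFactor.mkCtx T Klog t0N t0D = some C) : C.T = T ∧ C.Klog = Klog ∧ C.t0N = t0N ∧ C.t0D = t0D := by
  unfold UniversalFactor.mkCtx at h
  split_ifs at h
  split at h
  · simp only [Option.some.injEq] at h
    subst h
    exact ⟨rfl, rfl, rfl, rfl⟩
  · simp at h

/-- A context at `t₀ = 700508/100` has `C.t0 = lehmerT0`. [folklore] -/
theorem UniversalFactor.LCtx.t0_eq {C : UniversalFactor.LCtx} (hN : C.t0N = UniversalFactor.lehmerT0N)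
    (hD : C.t0D = UniversalFactor.lehmerT0D) : C.t0 = UniversalFactor.lehmerT0 := by
  simp [UniversalFactor.LCtx.t0, UniversalFactor.lehmerT0, hN, hD]


/-- `F_0 = lehmerCore`. [folklore] -/
theorem UniversalFactor.lehmerF_zero (t₀ : ℝ) (s : ℂ) :
    UniversalFactor.lehmerF t₀ ((0 : ℤ) : ℝ) s = UniversalFactor.lehmerCore t₀ s := by
  simp [UniversalFactor.lehmerF]

/-- **Soundness of `hiNodeRe`**: the box contains `Re F_0(½ + i(T_c + u_j))`. [folklore] -/
theorem UniversalFactor.hiNodeRe_mem {C : UniversalFactor.LCtx} (hC : C.Valid) {ρD : ℕ} (hρ : 0 < ρD)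
    {fwd : Bool} {c j : ℕ} {r : MI} (h : UniversalFactor.hiNodeRe C ρD fwd c j = some r) :
    MI.mem C.T.S (UniversalFactor.lehmerCore C.t0
      (1 / 2 + ((UniversalFactor.hiCellT ρD fwd c + UniversalFactor.hiU ρD j : ℝ) : ℂ) * I)).re r := by
  unfold UniversalFactor.hiNodeRe at h
  simp only at h
  split_ifs at h with hle
  split at h
  · rename_i F hF
    simp only [Option.some.injEq] at h
    subst h
    have hB : 0 < UniversalFactor.hiNodeB ρD := by
      unfold UniversalFactor.hiNodeB UniversalFactor.lehmerT0D UniversalFactor.glScale; positivity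
    have hBa : UniversalFactor.hiNodeB ρD ≤ (UniversalFactor.hiNodeA ρD fwd c j).toNat := by omega
    have hm := UniversalFactor.mem_lehmerFBox hC hB hBa hF
    have hcast : (((UniversalFactor.hiNodeA ρD fwd c j).toNat : ℕ) : ℝ) = ((UniversalFactor.hiNodeA ρD fwd c j : ℤ) : ℝ) := by
      have h0 : 0 ≤ UniversalFactor.hiNodeA ρD fwd c j := le_trans (by positivity) hle
      exact_mod_cast Int.toNat_of_nonneg h0
    rw [hcast, UniversalFactor.hiNode_eq hρ, UniversalFactor.lehmerF_zero] at hm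
    exact hm.1
  · simp at h

/-- **Soundness of `hiNodeRes`**: length and entries. [folklore] -/
theorem UniversalFactor.hiNodeRes_spec (C : UniversalFactor.LCtx) (ρD : ℕ) (fwd : Bool) (c : ℕ) :
    ∀ (n : ℕ) {L : List MI}, UniversalFactor.hiNodeRes C ρD fwd c n = some L →
      L.length = n ∧ ∀ j < n, UniversalFactor.hiNodeRe C ρD fwd c j = some (L.getD j ⟨0, 0⟩)
  | 0, L, h => by
      simp only [UniversalFactor.hiNodeRes, Option.some.injEq] at h
      subst h; simp
  | n + 1, L, h => by
      simp only [UniversalFactor.hiNodeRes] at h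
      split at h
      · rename_i L' r hL' hr
        simp only [Option.some.injEq] at h
        subst h
        obtain ⟨hlen, hget⟩ := UniversalFactor.hiNodeRes_spec C ρD fwd c n hL'
        refine ⟨by simp [hlen], fun j hj => ?_⟩
        rcases Nat.lt_succ_iff_lt_or_eq.1 hj with hj | hj
        · rw [hget j hj, List.getD_eq_getElem?_getD, List.getD_eq_getElem?_getD,
            List.getElem?_append_left (by omega)]
        · subst hj
          rw [hr, List.getD_eq_getElem?_getD, List.getElem?_append_right (by omega), hlen, Nat.sub_self]
          simp
      · simp at h

/-- **Soundness of `hiCellData`**: node boxes, `log T_c ∈ logT`, `Re(F(¼+iT_c/2) − F(¼+it₀/2)) ∈ d0`.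
[folklore] -/
theorem UniversalFactor.hiCellData_spec {C : UniversalFactor.LCtx} (hC : C.Valid) {ρD : ℕ} (hρ : 0 < ρD) {fwd : Bool} {c : ℕ}
    (hc : 2 * c + 1 ≤ 10 * ρD) {cell : UniversalFactor.HiCell} (h : UniversalFactor.hiCellData C ρD fwd c = some cell) :
    cell.res.length = 16 ∧ (∀ j < 16, UniversalFactor.hiNodeRe C ρD fwd c j = some (cell.res.getD j ⟨0, 0⟩)) ∧
      MI.mem C.T.S (Real.log (UniversalFactor.hiCellT ρD fwd c)) cell.logT ∧
      MI.mem C.T.S ((stirlingPrim (thetaArg (UniversalFactor.hiCellT ρD fwd c)) - stirlingPrim (thetaArg C.t0)).re) cell.d0 := by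
  unfold UniversalFactor.hiCellData at h
  simp only at h
  split at h
  · rename_i L P LN LD hL hP hLN hLD
    simp only [Option.some.injEq] at h
    subst h
    have hS := hC.tv.S_pos
    obtain ⟨hTd, hTdn⟩ := UniversalFactor.hiCellTd_le hρ fwd hc
    have hTn := UniversalFactor.hiCellTn_pos fwd hc (ρD := ρD)
    obtain ⟨hlen, hget⟩ := UniversalFactor.hiNodeRes_spec C ρD fwd c 16 hL
    have hcast : (((UniversalFactor.hiCellTn ρD fwd c).toNat : ℕ) : ℝ) = ((UniversalFactor.hiCellTn ρD fwd c : ℤ) : ℝ) := by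
      exact_mod_cast Int.toNat_of_nonneg hTn.le
    have hT : ((((UniversalFactor.hiCellTn ρD fwd c).toNat : ℕ) : ℝ) / (UniversalFactor.hiCellTd ρD : ℕ)) =
        UniversalFactor.hiCellT ρD fwd c := by
      rw [hcast]; rfl
    have hTpos : 0 < UniversalFactor.hiCellT ρD fwd c := by
      rw [← hT, hcast]; exact div_pos (by exact_mod_cast hTn) (by exact_mod_cast hTd)
    have ht0pos : 0 < C.t0 := by
      unfold UniversalFactor.LCtx.t0
      have h1 : (0:ℝ) < C.t0D := by exact_mod_cast hC.t0D_pos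
      have h2 : (0:ℝ) < C.t0N := by exact_mod_cast (lt_of_lt_of_le hC.t0D_pos hC.t0D_le)
      positivity
    refine ⟨hlen, hget, ?_, ?_⟩
    · -- logarithm
      have m1 := MI.mem_logNat hS hLN
      have m2 := MI.mem_logNat hS hLD
      have := MI.mem_sub m1 m2
      rw [← Real.log_div (by rw [hcast]; exact_mod_cast hTn.ne') (by exact_mod_cast hTd.ne'), hT] at this
      exact this
    · -- Stirling primitive
      have msp := (UniversalFactor.mem_spOf hS hC.tv.mem_pi hTd hTdn hP).1
      rw [hT] at msp
      have := MI.mem_sub msp hC.mem_reSP0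
      convert this using 1
      rw [UniversalFactor.stirlingPrim_thetaArg hTpos, UniversalFactor.stirlingPrim_thetaArg ht0pos]
      simp
  · simp at h

/-- **Soundness of `hiSideData`**: length and entries. [folklore] -/
theorem UniversalFactor.hiSideData_spec (C : UniversalFactor.LCtx) (ρD : ℕ) (fwd : Bool) :
    ∀ (n : ℕ) {L : List UniversalFactor.HiCell}, UniversalFactor.hiSideData C ρD fwd n = some L →
      L.length = n ∧ ∀ c < n, UniversalFactor.hiCellData C ρD fwd c = some (L.getD c UniversalFactor.hiCell0)
  | 0, L, h => by
      simp only [UniversalFactor.hiSideData, Option.some.injEq] at h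
      subst h; simp
  | n + 1, L, h => by
      simp only [UniversalFactor.hiSideData] at h
      split at h
      · rename_i L' d hL' hd
        simp only [Option.some.injEq] at h
        subst h
        obtain ⟨hlen, hget⟩ := UniversalFactor.hiSideData_spec C ρD fwd n hL'
        refine ⟨by simp [hlen], fun c hc => ?_⟩
        rcases Nat.lt_succ_iff_lt_or_eq.1 hc with hc | hc
        · rw [hget c hc, List.getD_eq_getElem?_getD, List.getD_eq_getElem?_getD,
            List.getElem?_append_left (by omega)]
        · subst hc
          rw [hd, List.getD_eq_getElem?_getD, List.getElem?_append_right (by omega), hlen, Nat.sub_self]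
          simp
      · simp at h

/-- **Soundness of `hiPointData`**. [folklore] -/
theorem UniversalFactor.hiPointData_spec {C : UniversalFactor.LCtx} {ρD CyB CyF : ℕ} {pt : UniversalFactor.HiPoint}
    (h : UniversalFactor.hiPointData C ρD CyB CyF = some pt) :
    pt.ρD = ρD ∧ UniversalFactor.hiSideData C ρD false CyB = some pt.bwd ∧
      UniversalFactor.hiSideData C ρD true CyF = some pt.fwd ∧ pt.h0 = UniversalFactor.hCheck C := by
  unfold UniversalFactor.hiPointData at h
  split at h
  · rename_i B F hB hF
    simp only [Option.some.injEq] at h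
    subst h
    exact ⟨rfl, hB, hF, rfl⟩
  · simp at h


/-- **Soundness of `hiExps`**: length and entries. [folklore] -/
theorem UniversalFactor.hiExps_spec {S : ℕ} (hS : 0 < S) :
    ∀ (xs : List MI) {es : List MI}, UniversalFactor.hiExps S xs = some es →
      es.length = xs.length ∧
        ∀ i < xs.length, ∀ x : ℝ, MI.mem S x (xs.getD i ⟨0, 0⟩) → MI.mem S (Real.exp x) (es.getD i ⟨0, 0⟩)
  | [], es, h => by
      simp only [UniversalFactor.hiExps, Option.some.injEq] at h
      subst h; simp
  | x :: xs, es, h => by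
      simp only [UniversalFactor.hiExps] at h
      split at h
      · rename_i e es' he hes'
        simp only [Option.some.injEq] at h
        subst h
        obtain ⟨hlen, hget⟩ := UniversalFactor.hiExps_spec hS xs hes'
        refine ⟨by simp [hlen], fun i hi y hy => ?_⟩
        cases i with
        | zero => simpa using MI.mem_exp hS he (by simpa using hy)
        | succ i =>
          simp only [List.length_cons, Nat.succ_lt_succ_iff] at hi
          simpa using hget i hi y (by simpa using hy)
      · simp at h

/-- The cell exponents: `−2a(2c+1)/ρD ∈ hiCellArgs[c]` (`a = A/AD`). [folklore] -/
theorem UniversalFactor.hiCellArgs_mem (S : ℕ) {A AD ρD Cy c : ℕ} (hρ : 0 < ρD) (hAD : 0 < AD) (hc : c < Cy) :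
    MI.mem S (-(2 * ((A : ℝ) / AD) * ((2 * c + 1) / ρD))) ((UniversalFactor.hiCellArgs S A AD ρD Cy).getD c ⟨0, 0⟩) := by
  unfold UniversalFactor.hiCellArgs
  rw [List.getD_eq_getElem?_getD, List.getElem?_map, List.getElem?_range hc]
  simp only [Option.map_some, Option.getD_some]
  have h := MI.mem_ofFrac S (-(2 * (A : ℤ) * (2 * (c : ℤ) + 1))) (q := ρD * AD) (by positivity)
  convert h using 1
  have hρr : (ρD : ℝ) ≠ 0 := by exact_mod_cast hρ.ne'
  have hADr : (AD : ℝ) ≠ 0 := by exact_mod_cast hAD.ne'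
  push_cast
  field_simp

/-- The length of `hiCellArgs`. [folklore] -/
theorem UniversalFactor.hiCellArgs_length (S A AD ρD Cy : ℕ) : (UniversalFactor.hiCellArgs S A AD ρD Cy).length = Cy := by
  simp [UniversalFactor.hiCellArgs]

/-- The node exponents: `∓2a u_j ∈ hiNodeArgs[j]`. [folklore] -/
theorem UniversalFactor.hiNodeArgs_mem (S : ℕ) {A AD ρD : ℕ} (fwd : Bool) (hρ : 0 < ρD) (hAD : 0 < AD) {j : ℕ} (hj : j < 16) :
    MI.mem S ((if fwd then -1 else 1) * (2 * ((A : ℝ) / AD) * UniversalFactor.hiU ρD j))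
      ((UniversalFactor.hiNodeArgs S A AD ρD fwd).getD j ⟨0, 0⟩) := by
  unfold UniversalFactor.hiNodeArgs
  rw [List.getD_eq_getElem?_getD, List.getElem?_map, List.getElem?_range hj]
  simp only [Option.map_some, Option.getD_some]
  have hsc : 0 < UniversalFactor.glScale := by unfold UniversalFactor.glScale; positivity
  have h := MI.mem_ofFrac S ((if fwd then -1 else 1) * (2 * (A : ℤ) * UniversalFactor.glNodes.getD j 0))
    (q := AD * ρD * UniversalFactor.glScale) (by positivity)
  convert h using 1
  have hρr : (ρD : ℝ) ≠ 0 := by exact_mod_cast hρ.ne'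
  have hADr : (AD : ℝ) ≠ 0 := by exact_mod_cast hAD.ne'
  have hscr : (UniversalFactor.glScale : ℝ) ≠ 0 := by exact_mod_cast hsc.ne'
  unfold UniversalFactor.hiU
  cases fwd <;> simp <;> field_simp

/-- The length of `hiNodeArgs`. [folklore] -/
theorem UniversalFactor.hiNodeArgs_length (S A AD ρD : ℕ) (fwd : Bool) : (UniversalFactor.hiNodeArgs S A AD ρD fwd).length = 16 := by
  simp [UniversalFactor.hiNodeArgs]

/-- The GL weight `W_j ∈ ofFrac glWeights[j] (ρD·10³⁶)`. [folklore] -/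
theorem UniversalFactor.hiWt_mem (S : ℕ) {ρD : ℕ} (hρ : 0 < ρD) (j : ℕ) :
    MI.mem S (UniversalFactor.hiWt ρD j) (MI.ofFrac S (UniversalFactor.glWeights.getD j 0) (ρD * UniversalFactor.glScale)) := by
  have hsc : 0 < UniversalFactor.glScale := by unfold UniversalFactor.glScale; positivity
  have h := MI.mem_ofFrac S (UniversalFactor.glWeights.getD j 0) (q := ρD * UniversalFactor.glScale) (by positivity)
  have e : UniversalFactor.hiWt ρD j =
      ((UniversalFactor.glWeights.getD j 0 : ℤ) : ℝ) / ((ρD * UniversalFactor.glScale : ℕ) : ℝ) := by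
    unfold UniversalFactor.hiWt; rw [Nat.cast_mul]
  rw [e]; exact h

/-- **Soundness of `hiCellSum`** (the interval-weight device): if `Ec_k ∋ e^{−2a_k m}`,
`En_k[j] ∋ e^{σ 2a_k u_j}`, `res[j] ∋ v_j`, the distances `m − σu_j ≥ 0` and `a₁ ≤ a ≤ a₂`, then
`Σ_{j<n} W_j e^{−2a(m − σ u_j)} v_j ∈ hiCellSum`. [folklore] -/
theorem UniversalFactor.hiCellSum_mem {S : ℕ} (hS : 0 < S) {ρD : ℕ} (hρ : 0 < ρD) {a₁ a₂ a m σ : ℝ}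
    (ha₁ : a₁ ≤ a) (ha₂ : a ≤ a₂) {res En1 En2 : List MI} {Ec1 Ec2 : MI} (v : ℕ → ℝ)
    (hEc1 : MI.mem S (Real.exp (-(2 * a₁ * m))) Ec1) (hEc2 : MI.mem S (Real.exp (-(2 * a₂ * m))) Ec2)
    (hEn1 : ∀ j < 16, MI.mem S (Real.exp (σ * (2 * a₁ * UniversalFactor.hiU ρD j))) (En1.getD j ⟨0, 0⟩))
    (hEn2 : ∀ j < 16, MI.mem S (Real.exp (σ * (2 * a₂ * UniversalFactor.hiU ρD j))) (En2.getD j ⟨0, 0⟩))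
    (hres : ∀ j < 16, MI.mem S (v j) (res.getD j ⟨0, 0⟩))
    (hd : ∀ j < 16, 0 ≤ m - σ * UniversalFactor.hiU ρD j) :
    ∀ n ≤ 16, MI.mem S (∑ j ∈ Finset.range n, UniversalFactor.hiWt ρD j * Real.exp (-(2 * a * (m - σ * UniversalFactor.hiU ρD j))) * v j)
      (UniversalFactor.hiCellSum S ρD res En1 En2 Ec1 Ec2 n)
  | 0, _ => by simp [UniversalFactor.hiCellSum, MI.mem_def]
  | n + 1, hn => by
      have ih := UniversalFactor.hiCellSum_mem hS hρ ha₁ ha₂ v hEc1 hEc2 hEn1 hEn2 hres hd n (by omega)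
      have hj : n < 16 := by omega
      rw [Finset.sum_range_succ]
      simp only [UniversalFactor.hiCellSum]
      refine MI.mem_add ih ?_
      -- the weight interval
      have hw1 : MI.mem S (Real.exp (-(2 * a₁ * (m - σ * UniversalFactor.hiU ρD n)))) (MI.mul S Ec1 (En1.getD n ⟨0, 0⟩)) := by
        have := MI.mem_mul hS hEc1 (hEn1 n hj)
        rw [← Real.exp_add] at this
        convert this using 2; ring
      have hw2 : MI.mem S (Real.exp (-(2 * a₂ * (m - σ * UniversalFactor.hiU ρD n)))) (MI.mul S Ec2 (En2.getD n ⟨0, 0⟩)) := by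
        have := MI.mem_mul hS hEc2 (hEn2 n hj)
        rw [← Real.exp_add] at this
        convert this using 2; ring
      have hdn := hd n hj
      have hW : MI.mem S (Real.exp (-(2 * a * (m - σ * UniversalFactor.hiU ρD n))))
          (MI.span (MI.mul S Ec2 (En2.getD n ⟨0, 0⟩)) (MI.mul S Ec1 (En1.getD n ⟨0, 0⟩))) :=
        MI.mem_span hw2 hw1 (Real.exp_le_exp.2 (by nlinarith)) (Real.exp_le_exp.2 (by nlinarith))
      have := MI.mem_mul hS (MI.mem_mul hS hW (hres n hj)) (UniversalFactor.hiWt_mem S hρ n)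
      convert this using 1
      ring

/-- **Soundness of `hiSideSum`**: with cell data `cells` (node boxes `∋ v c j`), weight tables for the
endpoints, and `a₁ ≤ a ≤ a₂`, the number `Σ_{c<n} Σ_{j<16} W_j e^{−2a((2c+1)/ρD − σu_j)} v_{cj}` lies in
`hiSideSum`. [folklore] -/
theorem UniversalFactor.hiSideSum_mem {S : ℕ} (hS : 0 < S) {ρD : ℕ} (hρ : 0 < ρD) {a₁ a₂ a σ : ℝ} (hσ : σ = 1 ∨ σ = -1)
    (ha₁ : a₁ ≤ a) (ha₂ : a ≤ a₂) {cells : List UniversalFactor.HiCell} {En1 En2 Ec1 Ec2 : List MI} (v : ℕ → ℕ → ℝ) {N : ℕ}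
    (hEc1 : ∀ c < N, MI.mem S (Real.exp (-(2 * a₁ * ((2 * c + 1) / ρD)))) (Ec1.getD c ⟨0, 0⟩))
    (hEc2 : ∀ c < N, MI.mem S (Real.exp (-(2 * a₂ * ((2 * c + 1) / ρD)))) (Ec2.getD c ⟨0, 0⟩))
    (hEn1 : ∀ j < 16, MI.mem S (Real.exp (σ * (2 * a₁ * UniversalFactor.hiU ρD j))) (En1.getD j ⟨0, 0⟩))
    (hEn2 : ∀ j < 16, MI.mem S (Real.exp (σ * (2 * a₂ * UniversalFactor.hiU ρD j))) (En2.getD j ⟨0, 0⟩))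
    (hres : ∀ c < N, ∀ j < 16, MI.mem S (v c j) ((cells.getD c UniversalFactor.hiCell0).res.getD j ⟨0, 0⟩)) :
    ∀ n ≤ N, MI.mem S (∑ c ∈ Finset.range n, ∑ j ∈ Finset.range 16,
        UniversalFactor.hiWt ρD j * Real.exp (-(2 * a * ((2 * c + 1) / ρD - σ * UniversalFactor.hiU ρD j))) * v c j)
      (UniversalFactor.hiSideSum S ρD cells En1 En2 Ec1 Ec2 n)
  | 0, _ => by simp [UniversalFactor.hiSideSum, MI.mem_def]
  | n + 1, hn => by
      have ih := UniversalFactor.hiSideSum_mem hS hρ hσ ha₁ ha₂ v hEc1 hEc2 hEn1 hEn2 hres n (by omega)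
      have hc : n < N := by omega
      rw [Finset.sum_range_succ]
      simp only [UniversalFactor.hiSideSum]
      refine MI.mem_add ih ?_
      have hd : ∀ j < 16, 0 ≤ (2 * (n : ℝ) + 1) / ρD - σ * UniversalFactor.hiU ρD j := by
        intro j _
        have hu := UniversalFactor.abs_hiU_le hρ j
        have h1 : (1 : ℝ) / ρD ≤ (2 * n + 1) / ρD := by
          apply div_le_div_of_nonneg_right _ (by exact_mod_cast hρ.le); linarith [(Nat.cast_nonneg n : (0:ℝ) ≤ n)]
        have h2 : |σ * UniversalFactor.hiU ρD j| ≤ 1 / ρD := by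
          rcases hσ with h | h <;> subst h <;> simpa using hu
        linarith [(abs_le.1 h2).2]
      exact UniversalFactor.hiCellSum_mem hS hρ ha₁ ha₂ (v n) (hEc1 n hc) (hEc2 n hc) hEn1 hEn2 (hres n hc) hd 16 le_rfl

/-- **Registered anchor `stub_hiSums`** of this file (`hiU` is the cast of `hiUQ`). [folklore] -/
theorem UniversalFactor.stub_hiSums : ∀ ρD j : ℕ, UniversalFactor.hiU ρD j = (UniversalFactor.hiUQ ρD j : ℝ) :=
  UniversalFactor.hiU_eq_cast

end Summit.RiemannHypothesis.RiemannHypothesis.Theorems
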